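import Mathlib
import Literature.NumberTheory.EllipticCurves.Smith2016.CongruentNumberGenusDeterminantRowSevenAForest
import Literature.NumberTheory.EllipticCurves.Smith2016.CongruentNumberGenusDeterminantRowSevenB

/-!
# Smith 2016, Theorem 2.2 row 7(a) for every `k`: `Σ₁(n) = det M_{7a}`, and `Σ₁(n)` or `Σ₂'(n)` odd `⟹ #Sel₂(E⁽ⁿ⁾) = 8` (`n ≡ 7 (8)`)

A. Smith, *The congruent numbers have positive natural density*, arXiv:1603.08479 [Smith2016CongruentDensity],
Table 2 row 7(a) (source `cnc.tex` l. 109–116): for `n ≡ 7 (mod 8)`, `ℒ_{7a}(n) = Σ_{d | n, d ≡ 7 (8)} g(d)ℒ(n/d)`,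
`M_{7a} = [[A + Aᵀ, Aᵀ, y + z, 0],[A, D_z, 0, y],[(y+z)ᵀ, 0, 0, 0],[0, yᵀ, 0, 0]]`; Thm. 2.2: `ℒ_{7a}(n) = det M_{7a}`;
by Thm. 2.1 of the source (= [TianYuanZhang2017] Thm. 1.2 as printed) `ℒ_{7a}(n) = Σ₁(n)` (the main block `d₀ ≡ 7`
with all other blocks `≡ 1 (8)`; the tree's bracket `B₇`).

What is proved (every number of prime factors; no named fact):
* `natCast_genusSum₁_eq_sum_powerset_seven` — `Σ₁(n) ≡ Σ_{B ⊆ [k], d_B ≡ 7 (8)} g(d_B) ℒ(d_{[k]∖B})`;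
* `genusSum₁_eq_det_sevenA` — **row 7(a)**: for `n = p₁⋯p_k ≡ 7 (mod 8)`, `Σ₁(n) ≡ det M_{7a} (mod 2)` with `M_{7a}` the
  iterated bordered block matrix `[[[[M₁, (t+z;0)],[(t+z;0)ᵀ, 0]], ((0;t);0)],[((0;t);0)ᵀ, 0]]`;
* `card_selmerGroup_two_eq_eight_of_odd_genusSum₁_seven` — `Σ₁(n)` odd `⟹ #Sel⁽²⁾(E⁽ⁿ⁾/ℚ) = 8`, and with row 7(b)
  (`RowSevenB`): **`card_selmerGroup_two_eq_eight_of_odd_genusSum_seven` — for every square-free `N ≡ 7 (mod 8)`,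
  `Σ₁(N)` odd or `Σ₂'(N)` odd `⟹ #Sel⁽²⁾(E_N/ℚ) = 8`** (Smith's Prop. 3.2, rows 7; the `2`-Selmer companion of
  Tian–Yuan–Zhang's Thm. 1.2 on `n ≡ 7 (8)`, no `L`-function).
-/

namespace Literature.NumberTheory.EllipticCurves.Smith2016

open _root_.Matrix Finset Literature.LinearAlgebra.Matrix Literature.Combinatorics.Enumerative
open Literature.NumberTheory.EllipticCurves.HeathBrown1994
open Literature.NumberTheory.EllipticCurves.TianYuanZhang2017
open Literature.NumberTheory.EllipticCurves.TianYuanZhang2017.W2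
open Literature.NumberTheory.EllipticCurves.MonskySelmerParity

variable {k : ℕ} (p : Fin k → ℕ)

section GenusSide

open scoped Classical in
/-- The row-7(a) pointed weight: for `n ≡ 7 (8)` and `d₀ ∈ D ∈ decompositions n`, `d₀` is a main block `≡ 7 (8)` iff
`d₀ ≡ 7 (8)` and all other blocks are `≡ 1 (8)`; the bracket summand is `ν₇(d₀) · ∏_{d ≠ d₀} [d ≡ 1 (8)] g(d)`.
[cite: TianYuanZhang2017, Thm. 1.2 and proof of Thm. 3.5 (2) (p0020 L123–L165: main block d₀ ≡ 7, n ≡ 7)] -/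
theorem natCast_bSeven_summand_eq_seven {n : ℕ} (h7 : n % 8 = 7) {D : Finset ℕ} (hD : D ∈ decompositions n)
    {d₀ : ℕ} (hd₀ : d₀ ∈ D) :
    ((if MainBlock D d₀ ∧ QSeven D d₀ then ∏ d ∈ D, gK d else 0 : ℕ) : ZMod 2) =
      (if d₀ % 8 = 7 then ((gK d₀ : ℕ) : ZMod 2) else 0) *
        ∏ d ∈ D.erase d₀, (if d % 8 = 1 then ((gK d : ℕ) : ZMod 2) else 0) := by
  by_cases hP : MainBlock D d₀ ∧ QSeven D d₀
  · have hM := hP.1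
    have hQ7 : d₀ % 8 = 7 := hP.2
    have hothers := others_one_of_seven_seven h7 hD hd₀ hM hQ7
    rw [if_pos hP, if_pos hQ7, Nat.cast_prod, ← mul_prod_erase D (fun d => ((gK d : ℕ) : ZMod 2)) hd₀]
    congr 1
    exact prod_congr rfl fun d hd => by rw [if_pos (hothers d (mem_of_mem_erase hd) (ne_of_mem_erase hd))]
  · rw [if_neg hP, Nat.cast_zero]
    by_cases hd7 : d₀ % 8 = 7
    · rw [if_pos hd7]
      by_contra hne
      have hall : ∀ d ∈ D.erase d₀, d % 8 = 1 := by
        intro d hd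
        by_contra hd1
        apply hne
        rw [prod_eq_zero hd (by rw [if_neg hd1]), mul_zero]
      apply hP
      refine ⟨⟨Or.inr (Or.inr hd7), fun d hd hdd => Or.inl (hall d (mem_erase.mpr ⟨hdd, hd⟩)), ?_⟩, hd7⟩
      rw [Finset.card_le_one]
      intro a ha b hb
      rw [mem_filter] at ha hb
      exact absurd (hall a ha.1) ha.2
    · rw [if_neg hd7, zero_mul]

open scoped Classical in
/-- **`Σ₁(n)` over index blocks for `n = p₁⋯p_k ≡ 7 (mod 8)`**: `Σ₁(n) ≡ Σ_{B ⊆ [k], d_B ≡ 7 (8)} g(d_B) · ℒ(d_{[k]∖B}) (mod 2)`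
— Smith's `ℒ_{7a}(n) = Σ_{d | n, d ≡ 7 (8)} g(d)ℒ(n/d)`. [cite: Smith2016CongruentDensity, Thm. 2.2 / Table 2 row 7(a) (source cnc.tex l. 109–116)] [cite: TianYuanZhang2017, Thm. 1.2 (n ≡ 7 (8): the sum Σ₁)] -/
theorem natCast_genusSum₁_eq_sum_powerset_seven (hp : ∀ i, (p i).Prime) (hinj : Function.Injective p)
    (h8 : (∏ i, p i) % 8 = 7) :
    ((genusSum₁ (∏ i, p i) (fun d => genusClassNumber (GenusField d)) : ℕ) : ZMod 2) =
      ∑ B ∈ (univ : Finset (Fin k)).powerset,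
        (if (∏ i ∈ B, p i) % 8 = 7 then ((genusClassNumber (GenusField (∏ i ∈ B, p i)) : ℕ) : ZMod 2) else 0) *
        ∑ D ∈ decompositions (∏ i ∈ univ \ B, p i), ∏ d ∈ D,
          (if d % 8 = 1 then ((genusClassNumber (GenusField d) : ℕ) : ZMod 2) else 0) := by
  rw [show (fun d => genusClassNumber (GenusField d)) = gK from rfl, genusSum₁_eq_bSeven h8, bSeven, coef, Nat.cast_sum]
  have hstep : ∀ D ∈ decompositions (∏ i, p i),
      ((∑ d₀ ∈ D.filter (fun d₀ => MainBlock D d₀), (if QSeven D d₀ then ∏ d ∈ D, gK d else 0) : ℕ) : ZMod 2) =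
        ∑ d₀ ∈ D, (if d₀ % 8 = 7 then ((gK d₀ : ℕ) : ZMod 2) else 0) *
          ∏ d ∈ D.erase d₀, (if d % 8 = 1 then ((gK d : ℕ) : ZMod 2) else 0) := by
    intro D hD
    rw [sum_filter, Nat.cast_sum]
    refine sum_congr rfl fun d₀ hd₀ => ?_
    rw [← natCast_bSeven_summand_eq_seven h8 hD hd₀]
    by_cases hM : MainBlock D d₀
    · rw [if_pos hM]
      by_cases hQ : QSeven D d₀
      · rw [if_pos hQ, if_pos ⟨hM, hQ⟩]
      · rw [if_neg hQ, if_neg (fun h => hQ h.2)]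
    · rw [if_neg hM, if_neg (fun h => hM h.1)]
  rw [sum_congr rfl hstep, show (∏ i, p i) = ∏ i ∈ (univ : Finset (Fin k)), p i from rfl,
    sum_decompositions_pointed_prod_eq p hp hinj _ _ univ,
    sum_filter_of_ne (fun B _ hB => by
      by_contra h
      rw [not_nonempty_iff_eq_empty] at h
      rw [h, prod_empty, if_neg (by norm_num), zero_mul] at hB
      exact hB rfl)]
  rfl

end GenusSide

section RowSevenA

/-- **Smith 2016, Theorem 2.2 row 7(a) — for every `k`**: for `n = p₁⋯p_k ≡ 7 (mod 8)` a product of distinct odd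
primes, `Σ₁(n) = ℒ_{7a}(n) ≡ det M_{7a} (mod 2)` where
`M_{7a} = [[A + Aᵀ, Aᵀ, t + z, 0],[A, D_z, 0, t],[(t+z)ᵀ, 0, 0, 0],[0, tᵀ, 0, 0]]` (as an iterated bordered block matrix),
`t = ((−1/pᵢ)₊)`, `z = ((2/pᵢ)₊)`.
[cite: Smith2016CongruentDensity, Thm. 2.2 row 7(a) / Table 2 (source cnc.tex l. 109–116) and §2.2 (cnc2.tex l. 44–52)] [cite: TianYuanZhang2017, Thm. 1.2 as printed (n ≡ 7 (8): the sum Σ₁)] -/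
theorem genusSum₁_eq_det_sevenA (hp : ∀ i, (p i).Prime) (hodd : ∀ i, Odd (p i))
    (hinj : Function.Injective p) (h8 : (∏ i, p i) % 8 = 7) :
    ((genusSum₁ (∏ i, p i) (fun d => genusClassNumber (GenusField d)) : ℕ) : ZMod 2) =
      (fromBlocks (fromBlocks (fromBlocks (legendreMatrix p + (legendreMatrix p)ᵀ) (legendreMatrix p)ᵀ (legendreMatrix p)
            (legendreDiagonal p 2))
          (replicateCol Unit (Sum.elim (fun i => addLegendreSym (-1) (p i) + addLegendreSym 2 (p i)) (0 : Fin k → ZMod 2)))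
          (replicateRow Unit (Sum.elim (fun i => addLegendreSym (-1) (p i) + addLegendreSym 2 (p i)) (0 : Fin k → ZMod 2))) 0)
        (replicateCol Unit (Sum.elim (Sum.elim (0 : Fin k → ZMod 2) (fun i => addLegendreSym (-1) (p i))) 0))
        (replicateRow Unit (Sum.elim (Sum.elim (0 : Fin k → ZMod 2) (fun i => addLegendreSym (-1) (p i))) 0)) 0).det := by
  rw [natCast_genusSum₁_eq_sum_powerset_seven p hp hinj h8, det_sevenA_eq_sum_genusWeight p hp hodd hinj h8]

end RowSevenA

section SelmerEight

/-- **`Σ₁(n)` odd `⟹ #Sel⁽²⁾(E⁽ⁿ⁾/ℚ) = 8` for `n = p₁⋯p_k ≡ 7 (mod 8)`** (`det M_{7a} = 1`; Smith's Prop. 3.2 for `x = 7a`).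
[cite: Smith2016CongruentDensity, Prop. 3.2 (chunk p0011 L58–L66) with Thm. 2.2 row 7(a)] [cite: TianYuanZhang2017, Thm. 1.2 as printed (n ≡ 7 (8))] -/
theorem card_selmerGroup_two_eq_eight_of_odd_genusSum₁_seven (hp : ∀ i, (p i).Prime) (hodd : ∀ i, Odd (p i))
    (hinj : Function.Injective p) (h8 : (∏ i, p i) % 8 = 7)
    (hodd1 : Odd (genusSum₁ (∏ i, p i) fun d => genusClassNumber (GenusField d))) :
    Nat.card ((congruentNumberCurve (∏ i, p i)).selmerGroup 2) = 8 := by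
  refine card_selmerGroup_two_eq_eight_of_det_border_border_ne_zero_seven p hp hodd hinj h8
    (Sum.elim (fun i => addLegendreSym (-1) (p i) + addLegendreSym 2 (p i)) (0 : Fin k → ZMod 2))
    (Sum.elim (0 : Fin k → ZMod 2) (fun i => addLegendreSym (-1) (p i))) (fun h0 => ?_)
  rw [← genusSum₁_eq_det_sevenA p hp hodd hinj h8, (ZMod.natCast_eq_one_iff_odd).mpr hodd1] at h0
  exact one_ne_zero h0

/-- **The `2`-Selmer companion of Tian–Yuan–Zhang's Thm. 1.2 on `n ≡ 7 (mod 8)`, for every `k`**: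
if `Σ₁(n)` or `Σ₂'(n)` is odd then `#Sel⁽²⁾(E⁽ⁿ⁾/ℚ) = 8` (`n = p₁⋯p_k ≡ 7 (mod 8)`).
[cite: TianYuanZhang2017, Thm. 1.2 as printed ("2^{−ρ(n)}𝓛(n) is even only if Σ₁ ≡ Σ₂' ≡ 0 (mod 2)")] [cite: Smith2016CongruentDensity, Prop. 3.2 with Thm. 2.2 rows 7(a), 7(b)] -/
theorem card_selmerGroup_two_eq_eight_of_odd_genusSum_seven (hp : ∀ i, (p i).Prime) (hodd : ∀ i, Odd (p i))
    (hinj : Function.Injective p) (h8 : (∏ i, p i) % 8 = 7)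
    (hor : Odd (genusSum₁ (∏ i, p i) fun d => genusClassNumber (GenusField d)) ∨
      Odd (genusSum₂' (∏ i, p i) fun d => genusClassNumber (GenusField d))) :
    Nat.card ((congruentNumberCurve (∏ i, p i)).selmerGroup 2) = 8 := by
  by_cases h1 : Odd (genusSum₁ (∏ i, p i) fun d => genusClassNumber (GenusField d))
  · exact card_selmerGroup_two_eq_eight_of_odd_genusSum₁_seven p hp hodd hinj h8 h1
  · have h2 : Odd (genusSum₂' (∏ i, p i) fun d => genusClassNumber (GenusField d)) := hor.resolve_left h1
    refine card_selmerGroup_two_eq_eight_of_genusSum_ne_seven p hp hodd hinj h8 ?_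
    rw [(ZMod.natCast_eq_one_iff_odd).mpr h2, (ZMod.natCast_eq_zero_iff_even).mpr (Nat.not_odd_iff_even.mp h1)]
    exact one_ne_zero

/-- **For every square-free `N ≡ 7 (mod 8)`: `Σ₁(N)` odd or `Σ₂'(N)` odd `⟹ #Sel⁽²⁾(E_N/ℚ) = 8`** (enumeration-free).
[cite: TianYuanZhang2017, Thm. 1.2 as printed (n ≡ 7 (8))] [cite: Smith2016CongruentDensity, Prop. 3.2 with Thm. 2.2 rows 7(a), 7(b)] -/
theorem card_selmerGroup_two_eq_eight_of_odd_genusSum_seven' {N : ℕ} (hN : Squarefree N) (h8 : N % 8 = 7)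
    (hor : Odd (genusSum₁ N fun d => genusClassNumber (GenusField d)) ∨
      Odd (genusSum₂' N fun d => genusClassNumber (GenusField d))) :
    Nat.card ((congruentNumberCurve N).selmerGroup 2) = 8 := by
  obtain ⟨k, p, hp, hp2, hinj, hprod⟩ :=
    exists_odd_prime_family_of_squarefree hN (Nat.odd_iff.mpr (by omega))
  have hodd : ∀ i, Odd (p i) := fun i => (hp i).odd_of_ne_two (hp2 i)
  subst hprod
  exact card_selmerGroup_two_eq_eight_of_odd_genusSum_seven p hp hodd hinj h8 hor

end SelmerEight

end Literature.NumberTheory.EllipticCurves.Smith2016
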